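import Summits.QuantumFields.YangMills.Theorems.IsotropyFromPowerCountingTemperedCurvatureMomentsThreePointChartBoundsFrames

/-!
# Three-point chart bounds VII: part 1 of stub B (ordered pairs, all lattice frames)

Support file for stub `stub_threePointChartBounds` (B) of reshape 4 of
`Cruxes/TemperedCurvatureMoments/Lines/Sketch.lean` (crux stmt-QuantumFields-17721, line `Sketch`).
`part_one`: one Schwartz order and, per derivative order, constants uniform over the frame menu.
References: Osterwalder–Schrader, Comm. Math. Phys. 31 (1973) §4.1, 42 (1975) §4; Glimm–Jaffe, Quantum
Physics (1987) Thm. 6.1.3, §19.5. [folklore]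
-/

noncomputable section

open scoped InnerProductSpace ComplexConjugate
open MeasureTheory Filter Set Complex
open _root_.Topology
open Literature.MathematicalPhysics.AQFT Literature.MathematicalPhysics.QuantumLattice
open Literature.MathematicalPhysics.QuantumFieldTheory
open scoped SchwartzMap LineDeriv
open Literature.MathematicalPhysics.QuantumLattice.SchwingerFamily (timeVec)
open Summit.QuantumFields.YangMills.Theorems.CurvatureKernel
open Summit.QuantumFields.YangMills.Cruxes.PlanarSpectralCone.TwoMirrorLightconeSlots.DiscSections (translateMulti_time_space)

namespace Summit.QuantumFields.YangMills.Theorems.TemperedCurvatureMoments.Sketch.ThreePointChartBounds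

/-! ## Part 1 of the stub: ordered pairs in all lattice frames -/

section PartOne

open Summit.QuantumFields.YangMills.Theorems.CurvatureBoostCovariance.Negative
  (OSPackage Translations Hypercubic EightFrameRP)

/-- `(2N)/(e δ/2) = (4N/e) · (1/δ)`. [folklore] -/
theorem ratio_eq (N : ℕ) {δ : ℝ} (hδ : 0 < δ) :
    ((2 * N : ℕ) : ℝ) / (Real.exp 1 * (δ / 2)) = (4 * N / Real.exp 1) * (1 / δ) := by
  have he : Real.exp 1 ≠ 0 := (Real.exp_pos 1).ne'
  push_cast
  field_simp
  ring

/-- **Part 1 of stub B in every lattice frame.**  For `S₁` with the OS package, translations, proper signed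
permutations and eight-frame reflection positivity: one Schwartz order `M₀` and, for every `N`, constants
`C, p` (uniform over the frame menu) such that for every frame `(n, v)`, mirror level `c`, gap
`δ ∈ (0,1]`, compactly supported `f₁, f₂` below the mirror forming an `n`-ordered pair, `g` beyond the
gap and `w ∈ {n, v}`: `|𝔖₃(f₁ ⊗ f₂ ⊗ ∂_wᴺ g)| ≤ C δ⁻ᵖ |f₁|_{M₀} |f₂|_{M₀} |g|_{M₀}`. [folklore] -/
theorem part_one (S₁ : SchwingerFamily (EuclideanSpace ℝ (Fin 4))) (hpkg : OSPackage S₁) (htr : Translations S₁)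
    (hhyp : Hypercubic S₁) (h8 : EightFrameRP S₁) :
    ∃ M₀ : ℕ, ∀ N : ℕ, ∃ (C : ℝ) (p : ℕ), ∀ (n v : EuclideanSpace ℝ (Fin 4)), ((∃ (μ ν : Fin 4) (s s' : ℝ), μ ≠ ν ∧ (s = 1 ∨ s = -1) ∧ (s' = 1 ∨ s' = -1) ∧
    n = s • (EuclideanSpace.single μ (1 : ℝ) : EuclideanSpace ℝ (Fin 4)) ∧
    v = s' • (EuclideanSpace.single ν (1 : ℝ) : EuclideanSpace ℝ (Fin 4))) ∨
  (∃ (μ ν : Fin 4) (s s' : ℝ), μ ≠ ν ∧ (s = 1 ∨ s = -1) ∧ (s' = 1 ∨ s' = -1) ∧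
    n = (Real.sqrt 2)⁻¹ • (s • (EuclideanSpace.single μ (1 : ℝ) : EuclideanSpace ℝ (Fin 4)) +
      s' • (EuclideanSpace.single ν (1 : ℝ) : EuclideanSpace ℝ (Fin 4))) ∧
    v = (Real.sqrt 2)⁻¹ • (s • (EuclideanSpace.single μ (1 : ℝ) : EuclideanSpace ℝ (Fin 4)) -
      s' • (EuclideanSpace.single ν (1 : ℝ) : EuclideanSpace ℝ (Fin 4))))) →
      ∀ δ : ℝ, 0 < δ → δ ≤ 1 → ∀ (c : ℝ) (f₁ f₂ g : 𝓢(EuclideanSpace ℝ (Fin 4), ℂ)),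
        tsupport (f₁ : EuclideanSpace ℝ (Fin 4) → ℂ) ⊆ {x | inner ℝ x n < c} →
        tsupport (f₂ : EuclideanSpace ℝ (Fin 4) → ℂ) ⊆ {x | inner ℝ x n < c} →
        tsupport (g : EuclideanSpace ℝ (Fin 4) → ℂ) ⊆ {x | c + δ < inner ℝ x n} →
        (∃ c' : ℝ, (tsupport (f₁ : EuclideanSpace ℝ (Fin 4) → ℂ) ⊆ {x | inner ℝ x n < c'} ∧
            tsupport (f₂ : EuclideanSpace ℝ (Fin 4) → ℂ) ⊆ {x | c' < inner ℝ x n}) ∨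
          (tsupport (f₂ : EuclideanSpace ℝ (Fin 4) → ℂ) ⊆ {x | inner ℝ x n < c'} ∧
            tsupport (f₁ : EuclideanSpace ℝ (Fin 4) → ℂ) ⊆ {x | c' < inner ℝ x n})) →
        ∀ w : EuclideanSpace ℝ (Fin 4), (w = n ∨ w = v) → ∀ F : 𝓢((Fin 3 → EuclideanSpace ℝ (Fin 4)), ℂ),
          IsTensorOf F ![f₁, f₂, ((LineDeriv.lineDerivOp w : 𝓢(EuclideanSpace ℝ (Fin 4), ℂ) →
            𝓢(EuclideanSpace ℝ (Fin 4), ℂ))^[N] g)] →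
            ‖S₁ 3 F‖ ≤ C * (1 / δ) ^ p * schwartzNorm M₀ f₁ * schwartzNorm M₀ f₂ * schwartzNorm M₀ g := by
  obtain ⟨M₂, C₂, hC₂, hS2⟩ := exists_norm_apply_le_schwartzNorm (S₁ 2)
  obtain ⟨M₄, C₄, hC₄, hS4⟩ := exists_norm_apply_le_schwartzNorm (S₁ 4)
  set M : ℕ := max M₂ M₄ with hM
  set AB : ℝ := Real.sqrt (|C₄| * (2 ^ (M₄ + 1)) ^ 4) *
    Real.sqrt (2 * (|C₂| * (2 ^ (M₂ + 1)) ^ 2 * 16 ^ M₂)) with hAB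
  refine ⟨M + 3 * M, fun N => ⟨(4 * N / Real.exp 1) ^ N * AB * ((2 : ℝ) ^ (3 * M) * 2 ^ (3 * M)), N, ?_⟩⟩
  intro n v hnv δ hδ hδ1 c f₁ f₂ g hf₁ hf₂ hg hord w hw F hF
  obtain ⟨R, hR0, hR1⟩ := exists_isometry_of_frameCond hnv
  obtain ⟨hR, hcone⟩ := frame_package S₁ hpkg htr hhyp h8 hnv R hR0 hR1
  set SR : SchwingerFamily (EuclideanSpace ℝ (Fin 4)) := fun m => (S₁ m).comp (linActMulti R) with hSR
  set L : EuclideanSpace ℝ (Fin 4) ≃L[ℝ] EuclideanSpace ℝ (Fin 4) := R.toContinuousLinearEquiv with hL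
  set f₁R := SchwartzMap.compCLMOfContinuousLinearEquiv ℂ L f₁ with hf₁R
  set f₂R := SchwartzMap.compCLMOfContinuousLinearEquiv ℂ L f₂ with hf₂R
  set gR := SchwartzMap.compCLMOfContinuousLinearEquiv ℂ L g with hgR
  -- supports in the frame
  rw [← hR0] at hf₁ hf₂ hg hord
  have hf₁s : tsupport (f₁R : EuclideanSpace ℝ (Fin 4) → ℂ) ⊆ {y | y 0 < c} :=
    tsupport_compCLMOfContinuousLinearEquiv_subset_of_inner R (· < c) hf₁
  have hf₂s : tsupport (f₂R : EuclideanSpace ℝ (Fin 4) → ℂ) ⊆ {y | y 0 < c} :=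
    tsupport_compCLMOfContinuousLinearEquiv_subset_of_inner R (· < c) hf₂
  have hgs : tsupport (gR : EuclideanSpace ℝ (Fin 4) → ℂ) ⊆ {y | c + δ < y 0} :=
    tsupport_compCLMOfContinuousLinearEquiv_subset_of_inner R (fun t => c + δ < t) hg
  have hordR : ∃ c' : ℝ, (tsupport (f₁R : EuclideanSpace ℝ (Fin 4) → ℂ) ⊆ {y | y 0 < c'} ∧
      tsupport (f₂R : EuclideanSpace ℝ (Fin 4) → ℂ) ⊆ {y | c' < y 0}) ∨
      (tsupport (f₂R : EuclideanSpace ℝ (Fin 4) → ℂ) ⊆ {y | y 0 < c'} ∧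
      tsupport (f₁R : EuclideanSpace ℝ (Fin 4) → ℂ) ⊆ {y | c' < y 0}) := by
    obtain ⟨c', h⟩ := hord
    refine ⟨c', ?_⟩
    rcases h with ⟨h1, h2⟩ | ⟨h2, h1⟩
    · exact Or.inl ⟨tsupport_compCLMOfContinuousLinearEquiv_subset_of_inner R (· < c') h1,
        tsupport_compCLMOfContinuousLinearEquiv_subset_of_inner R (fun t => c' < t) h2⟩
    · exact Or.inr ⟨tsupport_compCLMOfContinuousLinearEquiv_subset_of_inner R (· < c') h2,
        tsupport_compCLMOfContinuousLinearEquiv_subset_of_inner R (fun t => c' < t) h1⟩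
  -- the derivative direction in the frame
  obtain ⟨w', hw', hLw⟩ : ∃ w' : EuclideanSpace ℝ (Fin 4), (w' = EuclideanSpace.single (0 : Fin 4) (1 : ℝ) ∨
      w' = EuclideanSpace.single (1 : Fin 4) (1 : ℝ)) ∧ L w' = w := by
    rcases hw with rfl | rfl
    · exact ⟨_, Or.inl rfl, hR0⟩
    · exact ⟨_, Or.inr rfl, hR1⟩
  -- the value in the frame
  have hval : S₁ 3 F = SR 3 (SchwartzMap.tensorFin 3 ![f₁R, f₂R,
      ((∂_{w'} : 𝓢(EuclideanSpace ℝ (Fin 4), ℂ) → 𝓢(EuclideanSpace ℝ (Fin 4), ℂ))^[N]) gR]) := by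
    rw [hF.unique (isTensorOf_tensorFin _), hgR, iterate_lineDerivOp_compCLMOfContinuousLinearEquiv, hLw, hSR]
    simp only [ContinuousLinearMap.comp_apply]
    rw [hf₁R, hf₂R, hL, linActMulti_tensorFin_three_comp]
  -- the standard-frame bound
  have hE3 := fun π F' hF' => permTest_frame S₁ hpkg.2.2.2.2.1 R (m := 3) π F' hF'
  have key := norm_three_point_standard SR hR hcone hE3 M₂ C₂ (bound_frame S₁ R hC₂ hS2) (le_max_left _ _)
    M₄ C₄ (bound_frame S₁ R hC₄ hS4) (le_max_right _ _) N hδ hδ1 c f₁R f₂R gR hf₁s hf₂s hgs hordR hw'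
  rw [hval]
  refine key.trans ?_
  -- Schwartz norms of the pulled-back functions and the shape of the constant
  have hn1 : schwartzNorm (M + 3 * M) f₁R ≤ schwartzNorm (M + 3 * M) f₁ :=
    schwartzNorm_compCLMOfContinuousLinearEquiv_isometry_le R _ f₁
  have hn2 : schwartzNorm (M + 3 * M) f₂R ≤ schwartzNorm (M + 3 * M) f₂ :=
    schwartzNorm_compCLMOfContinuousLinearEquiv_isometry_le R _ f₂
  have hn3 : schwartzNorm (M + 3 * M) gR ≤ schwartzNorm (M + 3 * M) g :=
    schwartzNorm_compCLMOfContinuousLinearEquiv_isometry_le R _ g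
  have h01 := schwartzNorm_nonneg (M + 3 * M) f₁R
  have h02 := schwartzNorm_nonneg (M + 3 * M) f₂R
  have h03 := schwartzNorm_nonneg (M + 3 * M) gR
  have h0f₁ := schwartzNorm_nonneg (M + 3 * M) f₁
  have h0f₂ := schwartzNorm_nonneg (M + 3 * M) f₂
  have hr : ((2 * N : ℕ) : ℝ) / (Real.exp 1 * (δ / 2)) = (4 * N / Real.exp 1) * (1 / δ) := ratio_eq N hδ
  rw [hr, mul_pow, ← hAB]
  have hK0 : 0 ≤ (4 * N / Real.exp 1) ^ N * (1 / δ) ^ N * AB * ((2 : ℝ) ^ (3 * M) * 2 ^ (3 * M)) := by positivity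
  calc (4 * N / Real.exp 1) ^ N * (1 / δ) ^ N * AB * ((2 : ℝ) ^ (3 * M) * 2 ^ (3 * M)) *
        (schwartzNorm (M + 3 * M) f₁R * schwartzNorm (M + 3 * M) f₂R * schwartzNorm (M + 3 * M) gR)
      ≤ (4 * N / Real.exp 1) ^ N * (1 / δ) ^ N * AB * ((2 : ℝ) ^ (3 * M) * 2 ^ (3 * M)) *
        (schwartzNorm (M + 3 * M) f₁ * schwartzNorm (M + 3 * M) f₂ * schwartzNorm (M + 3 * M) g) :=
        mul_le_mul_of_nonneg_left (mul_le_mul (mul_le_mul hn1 hn2 h02 h0f₁) hn3 h03 (mul_nonneg h0f₁ h0f₂)) hK0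
    _ = _ := by ring

end PartOne

end Summit.QuantumFields.YangMills.Theorems.TemperedCurvatureMoments.Sketch.ThreePointChartBounds

end
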